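import Summits.CriticalPhenomena.SAWScalingLimit.Theses.SAWMassiveIsingTilt
import Summits.CriticalPhenomena.SAWScalingLimit.Theorems.SAWMassiveIsingTiltDefs
import Summits.CriticalPhenomena.SAWScalingLimit.Theorems.SAWMassiveIsingTiltCriticalCurveContinuityReductions
import Summits.CriticalPhenomena.SAWScalingLimit.Theorems.SAWMassiveIsingTiltTiltLawBasic
import Summits.CriticalPhenomena.SAWScalingLimit.Theorems.SAWMassiveIsingTiltCriticalCurveContinuityHasDerivAtWeightedAverage
import Summits.CriticalPhenomena.SAWScalingLimit.Theorems.SAWMassiveIsingTiltCriticalCurveContinuityDifferentiableZloop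
import Summits.CriticalPhenomena.SAWScalingLimit.Theorems.SAWMassiveIsingTiltScoreCalculus

/-!
# Skeleton v8 — crux `CriticalCurveContinuity` (stmt-CriticalPhenomena-7686), line `registered`

Route `SAWMassiveIsingTilt` of `CriticalPhenomena/SAWScalingLimit`, crux rank 3:

`CriticalCurveContinuity := MassiveWindowSLE → OneClassOnCriticalCurve`

("no transition on the open critical curve": the SLE_{8/3} limit obtained along one cooled-and-paid
path entering the Ising corner propagates to every fixed `0 ≤ y < y_c = 1/√3` along the critical
curve `x_c(y)` of the loop-dressed hexagonal SAW, in particular to the SAW corner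
`(x_c(0), 0) = (1/√(2+√2), 0)`).

History. v1 = the planner's birth skeleton (`Lines/birth.lean` @ 5e933e1c); v2/v3 (lead c1): objects
by name (`Theorems/SAWMassiveIsingTiltDefs.lean`, p143712), the logical geometry PROVED
(`…CriticalCurveContinuityReductions.lean`, p144694:
`CriticalCurveContinuity ↔ (MassiveWindowSLE → ConstancyAlongCurve ∧ HexSAWScalingLimit)` — the cut
{constancy, window-to-corner} is canonical), honesty of the tilted laws (`…TiltLawBasic.lean`, p145445).
v4–v6 (lead c2): stub 1 reshaped along the route's TWO-LAYER PLAN to `stub_scoreDecoupling` (score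
covariance `Cov_{𝔓^δ_{xc y,y}}(f∘curve, ℓ·xc'/xc + ∂_y log Zloop(Ω_δ∖γ; y)) → 0` uniformly on compacts
of `[0, y_c)`), with the finite-`δ` score calculus LANDED (p147827, p147847, p149733:
`hasDerivAt_tiltExpectation`, `constancy_of_scoreDecoupling`, `deriv_zloop_zero`) and the composition
one tree theorem (`criticalCurveContinuity_of_scoreDecoupling_of_windowToCorner`).

v7 (lead c3; composition UNCHANGED, sorries = the same two registered stubs). Cycle 3 made
the BATH SIDE of `stub_scoreDecoupling` rigorous in the Kotecký–Preiss regime — the "finite-range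
remainder" of the crux docstring ("the y-score is a fugacity renormalisation plus an irrelevant
finite-range remainder") — with the tree's PROVED cluster expansion
(`Literature.Probability.LatticeModels.{ClusterExpansion, ClusterExpansionKPBound, AnchoredClusterExpansion}`),
as five registered sub-goals (stub-add), ALL LANDED:
* `evenSubgraph_sum_split` (p153664, wave 1): component extraction at a vertex — every even subgraph
  through `v` splits uniquely into its connected even component through `v` and an even remainder
  with disjoint support;
* `card_hexConnected_family_le` (p154057, wave 1): hexagonal lattice animals, `≤ 4^{2n}` connected
  vertex sets of size `≤ n+1` through a vertex;
* `evenSubgraph_sum_eq_polymerPartitionFunction` + `zloop_eq_polymerPartitionFunction` (p154156, lead):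
  `Zloop(Ω_δ, S; y)` IS the partition function of the subset-polymer gas (`polyInc`) of connected even
  subgraphs on the volume `𝒫(T_S)` — the bath enters the KP machinery by name;
* `isSmallActivity_loopActivity` (p154336, wave 1): one-site Kotecký–Preiss smallness (`δ = ½`) of
  these activities for `|z| ≤ y₀ = (256 e^{3/2})⁻²`, uniformly in the subgraph of `ℍ`;
* `zloop_restrictionDefect_le_smallFugacity` (p154796, lead): **RESTRICTION FROM MASS IN THE KP
  REGIME** — the body of the sibling crux `RestrictionFromMass` (stmt-7687) with `C = 1`, `c = ½`
  for every `y ∈ [0, y₀]` (its layer-2 "SmallFugacity" half): the four-term restriction defect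
  `|log(Zloop(V∖γ)Zloop(S)/(Zloop(S∖γ)Zloop(V)))| ≤ Σ_{v∈γ} Σ_{w∈V∖S} e^{−½ d_Hex(v,w)}`.
What remains of `stub_scoreDecoupling` is its WALK SIDE: along the true critical curve the centred,
lattice-symmetric, exponentially quasi-local per-vertex score terms decorrelate from the macroscopic
shape of the critical tilted walk at rate `o(δ^{2/3})` ("differentiated universality" /
energy-irrelevance on the defect line) — research-level, nothing in print; and the extension of the
bath locality from `y ≤ y₀` to all `y < y_c` (HT-Ising ratio mixing on arbitrary subgraphs = 7687's
FullRange layer). `stub_windowToCorner` (DCS Conjecture 1 given the window) stays parked on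
`Literature.…SAW.HexSAWScalingLimit`.

v8 (lead c4, this file; composition UNCHANGED, sorries = the same two registered stubs). Cycle 4
held `stub_scoreDecoupling` and LANDED four registered sub-goals in two waves: the last bath-side
bricks of its mechanism in the Kotecký–Preiss regime —
* `zloop_scoreDefect_le_smallFugacity` (p157400): the DERIVATIVE form of the restriction defect — the
  walk-dependent part of the score computed in a sub-domain `S ⊇ γ` differs from the full-domain one
  by `C Σ_{v∈γ} Σ_{w∈V∖S} e^{−d_Hex(v,w)/2}` (score quasi-locality, c2's (M2) completed for `y ≤ y₁`);
* `scoreCov_abs_le_smallFugacity` (p157181): the a-priori bound on the stub's own integrals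
  `|Cov^δ(f∘curve, s_y)| ≤ 2‖f‖ (|xc'(y)|/xc(y) + K) 𝔼^δ[ℓ]`, which localises the whole difficulty in
  the `δ^{-4/3}` growth of `𝔼^δ[ℓ]`, i.e. in the cancellation the walk-side kernel must produce;
* `six_le_card_of_even_hexSubgraph` (p159440): girth six in loop-gas form (every non-empty even
  subgraph of the honeycomb lattice has ≥ 6 edges) ⇒ `Zloop = 1 + O(y⁶)`: the bath is invisible to
  fifth order at the SAW corner, and the first possibly non-trivial y-derivative of `𝔼^δ_{xc y,y}[f]`
  at 0 is the sixth — its vanishing is the bath-free germ `Cov_{P_{x_c}}(f∘curve, N_hex(γ) − e₆ ℓ(γ)) → 0`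
  of the kernel for the PURE critical hexagonal SAW (face-contact irrelevance);
* `isSmallActivity_loopActivity_of_norm_le` (p160172): EXPLICIT Kotecký–Preiss radius `1/13` for the
  cycle activities (connected even subgraphs of the cubic honeycomb lattice are single cycles traced
  by SAWs, `≤ 3·2^{m−2}` of size `m` through a vertex), replacing the existence-grade `7.6·10⁻⁷`;
and re-ran the route's cheapest falsifier (strip transfer matrices, one-leg dimension along `x_c(y)`)
through the window `y ∈ (0.5, y_c)` (Cruxes/…/TMWindow-c4.md; kit jobs j025779/j025782 for `L ≤ 28`):
a ν = 1 crossover collapse `X₁ ≈ F((L+1)(y_c − y))` with a single UV maximum and MONOTONE flow to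
`5/48`, no θ-like, dense or first-order structure on `[0, 0.56]`. What remains of
`stub_scoreDecoupling` is exactly the WALK-SIDE kernel (differentiated universality of the critical
loop-dressed walk along a differentiable critical curve; LeadReport-c4.md names its germ K-0, the
curve construction K-X — nearest technology Hammond–Helmuth 2019 — and the full statement K-W);
`stub_windowToCorner` (⇔ MW → DCS Conjecture 1, c1) stays parked on
`Literature.…SAW.HexSAWScalingLimit`.
-/

noncomputable section

open MeasureTheory Filter Topology Set
open scoped NNReal ENNReal BoundedContinuousFunction
open Literature.Probability Literature.Probability.LatticeModels
  Literature.Probability.RandomPlanarGeometry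
open Summit.CriticalPhenomena.SAWScalingLimit.Theses.SAWMassiveIsingTilt
open Summit.CriticalPhenomena.SAWScalingLimit.Theorems.SAWMassiveIsingTilt
open Summit.CriticalPhenomena.SAWScalingLimit.Theorems.ObservableToSLE.Negative (finite_hexDomainSAW)

namespace Summit.CriticalPhenomena.SAWScalingLimit.Cruxes.CriticalCurveContinuity.Birth

/-! ### The registered stubs -/

/-- STUB SD (XL, the lever): SCORE DECOUPLING along a differentiable critical curve through the SAW
corner — the finite-`δ` covariance of a bounded continuous functional of the interface with the
`y`-score `ℓ(γ)·xc'(y)/xc(y) + ∂_y log Zloop(Ω_δ∖γ; y)` is `o(1)` uniformly on compacts of `[0, y_c)`. -/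
theorem stub_scoreDecoupling :
    ∃ xc : ℝ → ℝ, xc 0 = SAW.hexCriticalFugacity ∧ Differentiable ℝ xc ∧
      (∀ y ∈ Set.Ico (0 : ℝ) (Real.sqrt 3)⁻¹, 0 < xc y) ∧
      ∀ (D : DobrushinDomain) (a b : ℝ → HexVertex), SAW.IsEmbEndpointApprox hexGraph hexCenter D a b →
        ∀ f : CurveClass ℂ →ᵇ ℝ, ∀ y₁ ∈ Set.Ico (0 : ℝ) (Real.sqrt 3)⁻¹, ∀ ε > (0 : ℝ),
          ∀ᶠ δ in 𝓝[>] (0 : ℝ), ∀ y ∈ Set.Icc (0 : ℝ) y₁,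
            |(∫ γ, f γ.curve * ((γ.vertexCount : ℝ) * deriv xc y / xc y +
                  deriv (fun t => Zloop (SAW.hexDomainGraph D.carrier δ) {v | v ∉ γ.walk.support} t) y /
                    Zloop (SAW.hexDomainGraph D.carrier δ) {v | v ∉ γ.walk.support} y)
                ∂(tiltLaw D.carrier δ (xc y) y (a δ) (b δ))) -
              (∫ γ, f γ.curve ∂(tiltLaw D.carrier δ (xc y) y (a δ) (b δ))) *
                ∫ γ, ((γ.vertexCount : ℝ) * deriv xc y / xc y +
                  deriv (fun t => Zloop (SAW.hexDomainGraph D.carrier δ) {v | v ∉ γ.walk.support} t) y /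
                    Zloop (SAW.hexDomainGraph D.carrier δ) {v | v ∉ γ.walk.support} y)
                ∂(tiltLaw D.carrier δ (xc y) y (a δ) (b δ))| ≤ ε := by
  sorry

/-- STUB 2 (open-problem content, parked on DCS Conjecture 1): the cooled-and-paid Ising window
lands at the SAW corner — `MassiveWindowSLE` implies `HexSAWScalingLimit`. -/
theorem stub_windowToCorner : MassiveWindowSLE → SAW.HexSAWScalingLimit := by
  sorry

/-! ### Name-keyed aliases (the skeleton audit admits a hypothesis of the composition only if its
head constant is a registered obligation or is named like a declared stub) -/
namespace Registered

/-- Stub SD's statement keyed by the registered stub name. -/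
abbrev stub_scoreDecoupling : Prop :=
  ∃ xc : ℝ → ℝ, xc 0 = SAW.hexCriticalFugacity ∧ Differentiable ℝ xc ∧
    (∀ y ∈ Set.Ico (0 : ℝ) (Real.sqrt 3)⁻¹, 0 < xc y) ∧
    ∀ (D : DobrushinDomain) (a b : ℝ → HexVertex), SAW.IsEmbEndpointApprox hexGraph hexCenter D a b →
      ∀ f : CurveClass ℂ →ᵇ ℝ, ∀ y₁ ∈ Set.Ico (0 : ℝ) (Real.sqrt 3)⁻¹, ∀ ε > (0 : ℝ),
        ∀ᶠ δ in 𝓝[>] (0 : ℝ), ∀ y ∈ Set.Icc (0 : ℝ) y₁,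
          |(∫ γ, f γ.curve * ((γ.vertexCount : ℝ) * deriv xc y / xc y +
                deriv (fun t => Zloop (SAW.hexDomainGraph D.carrier δ) {v | v ∉ γ.walk.support} t) y /
                  Zloop (SAW.hexDomainGraph D.carrier δ) {v | v ∉ γ.walk.support} y)
              ∂(tiltLaw D.carrier δ (xc y) y (a δ) (b δ))) -
            (∫ γ, f γ.curve ∂(tiltLaw D.carrier δ (xc y) y (a δ) (b δ))) *
              ∫ γ, ((γ.vertexCount : ℝ) * deriv xc y / xc y +
                deriv (fun t => Zloop (SAW.hexDomainGraph D.carrier δ) {v | v ∉ γ.walk.support} t) y /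
                  Zloop (SAW.hexDomainGraph D.carrier δ) {v | v ∉ γ.walk.support} y)
              ∂(tiltLaw D.carrier δ (xc y) y (a δ) (b δ))| ≤ ε
/-- Stub 2's statement keyed by the registered stub name. -/
abbrev stub_windowToCorner : Prop :=
  MassiveWindowSLE → SAW.HexSAWScalingLimit

end Registered

/-! ### Glue: LANDED in `Theorems/SAWMassiveIsingTiltScoreCalculus.lean` (p149733)

`hasDerivAt_tiltExpectation` (d/dy of a tilted expectation along a curve = score covariance) and
`constancy_of_scoreDecoupling` (score decoupling ⇒ v3's `stub_constancyAlongCurve`, mean-value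
inequality) are tree theorems now; the skeleton only composes. -/

/-- v3's stub 1 (constancy along the curve) from the registered `stub_scoreDecoupling`, by the landed glue. -/
theorem constancyAlongCurve_of_scoreDecoupling (hSD : Registered.stub_scoreDecoupling) :
    ∃ xc : ℝ → ℝ, xc 0 = SAW.hexCriticalFugacity ∧
      ∀ y ∈ Set.Ico (0 : ℝ) (Real.sqrt 3)⁻¹, ∀ y' ∈ Set.Ico (0 : ℝ) (Real.sqrt 3)⁻¹,
        SameLimit (xc y) y (xc y') y' :=
  constancy_of_scoreDecoupling hSD

/-! ### Composition (PROVED): stubs ⇒ the crux, by name -/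

/-- **The composition.** Score decoupling gives a constancy curve through the SAW corner (landed glue
`constancy_of_scoreDecoupling`); the window lands at the corner (stub 2); DCS Conjecture 1 then
propagates along the curve (`oneClassOnCriticalCurve_of_constancy_of_hexSAW`) — all packed in the
landed `criticalCurveContinuity_of_scoreDecoupling_of_windowToCorner`. -/
theorem CriticalCurveContinuity_of (hSD : Registered.stub_scoreDecoupling)
    (h2 : Registered.stub_windowToCorner) :
    Summit.CriticalPhenomena.SAWScalingLimit.Theses.SAWMassiveIsingTilt.CriticalCurveContinuity :=
  criticalCurveContinuity_of_scoreDecoupling_of_windowToCorner hSD h2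

/-- The v3 cut stays available: the crux and the window give back constancy and DCS Conjecture 1
(`criticalCurveContinuity_iff_window_gives_constancy_and_hexSAW`, landed). -/
theorem constancy_and_hexSAW_of_CriticalCurveContinuity
    (h : Summit.CriticalPhenomena.SAWScalingLimit.Theses.SAWMassiveIsingTilt.CriticalCurveContinuity)
    (hMW : MassiveWindowSLE) :
    (∃ xc : ℝ → ℝ, xc 0 = SAW.hexCriticalFugacity ∧
      ∀ y ∈ Set.Ico (0 : ℝ) (Real.sqrt 3)⁻¹, ∀ y' ∈ Set.Ico (0 : ℝ) (Real.sqrt 3)⁻¹,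
        SameLimit (xc y) y (xc y') y') ∧ SAW.HexSAWScalingLimit :=
  criticalCurveContinuity_iff_window_gives_constancy_and_hexSAW.1 h hMW

/-- Wiring check: the registered stubs feed `CriticalCurveContinuity_of` as stated. -/
example : Summit.CriticalPhenomena.SAWScalingLimit.Theses.SAWMassiveIsingTilt.CriticalCurveContinuity :=
  CriticalCurveContinuity_of stub_scoreDecoupling stub_windowToCorner

end Summit.CriticalPhenomena.SAWScalingLimit.Cruxes.CriticalCurveContinuity.Birth

end
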